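import Summits.AtomisticToContinuum.Crystallization.Theses.SquareWellLayerCake

/-!
# Negative knowledge for crux `SquareWellLayerCake.GapTwelveToBarlow` (stmt-AtomisticToContinuum-15807), II:
# the witness lattice — fcc with (100) gaps alternating `7/10, 33/50`
# (standing disprover, cycle 1; supports 15807)

Site labels are integer triples `(ℓ, p, q)`; layer `ℓ` is the unit square lattice `(p, q)` shifted by
`(1/2, 1/2)` when `ℓ` is odd, placed at height `Z ℓ = (17/25) ℓ + (1/50)(ℓ % 2)` along the FIRST axis (`pos`).
This is the fcc lattice in its (100) description (nearest-neighbour distance `1`, ideal gap `1/√2 ≈ 0.707`)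
with the gaps replaced by `7/10` (above even layers) and `33/50` (above odd layers).

* `le_dist_pos_sq`, `le_dist_pos` — uniform discreteness: distinct sites are `≥ √(2339/2500) ≥ 55/57` apart;
* `nbr`, `dist_nbr_le`, `eq_nbr_of_dist_sq_le` — every site has exactly twelve others within `11/10`, all of
  them within `1` (squared distances `1`, `99/100`, `2339/2500`): the gap-twelve hypothesis of the crux holds
  at EVERY site of the infinite lattice;
* `norm_pairSum_nbr` — the up/down neighbours `(1, r, r)` and `(−1, r−1, r−1)` have offsets summing to
  `(±1/25, 0, 0)`: the defect fed to `Negative.PairSumObstruction.not_matched_of_short_pairSum` in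
  `Negative.WithoutGroundState`.

Nothing here closes an item; no theorem concludes a Theses decl.
-/

noncomputable section

open scoped BigOperators
open Filter Topology

namespace Summit.AtomisticToContinuum.Crystallization.Theorems.GapTwelveToBarlow.Negative.WitnessLattice

/-! ## §3 The witness lattice: unit square layers, gaps alternating `7/10` and `33/50`

Site labels are integer triples `(ℓ, p, q)`; layer `ℓ` is the unit square lattice `(p, q)` shifted by
`(1/2, 1/2)` when `ℓ` is odd, placed at height `Z ℓ = (17/25) ℓ + (1/50)(ℓ % 2)` along the FIRST axis.
This is the fcc lattice in its (100) description (nearest-neighbour distance `1`, ideal gap `1/√2`) with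
the gaps replaced by `7/10` (above even layers) and `33/50` (above odd layers): bond lengths
`1` (in-layer), `√(99/100)`, `√(2339/2500) ≈ 0.9672 ≥ 55/57 ≈ 0.9649`; second distances `≥ 1.36 > 11/10`. -/

/-- Position of the site labelled `u = (ℓ, p, q)`. -/
def pos (u : ℤ × ℤ × ℤ) : (EuclideanSpace ℝ (Fin 3)) :=
  !₂[(17 : ℝ) / 25 * (u.1 : ℝ) + 1 / 50 * ((u.1 % 2 : ℤ) : ℝ),
     (u.2.1 : ℝ) + ((u.1 % 2 : ℤ) : ℝ) / 2,
     (u.2.2 : ℝ) + ((u.1 % 2 : ℤ) : ℝ) / 2]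

/-- First coordinate (the stacking direction). -/
@[simp] theorem pos_apply_zero (u : ℤ × ℤ × ℤ) :
    pos u 0 = (17 : ℝ) / 25 * (u.1 : ℝ) + 1 / 50 * ((u.1 % 2 : ℤ) : ℝ) := rfl

/-- Second coordinate. -/
@[simp] theorem pos_apply_one (u : ℤ × ℤ × ℤ) : pos u 1 = (u.2.1 : ℝ) + ((u.1 % 2 : ℤ) : ℝ) / 2 := rfl

/-- Third coordinate. -/
@[simp] theorem pos_apply_two (u : ℤ × ℤ × ℤ) : pos u 2 = (u.2.2 : ℝ) + ((u.1 % 2 : ℤ) : ℝ) / 2 := rfl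

/-- Squared distance of two sites in terms of the label differences and the parity jump
`e = ℓ' % 2 − ℓ % 2`. -/
theorem dist_pos_sq (ℓ p q ℓ' p' q' : ℤ) :
    dist (pos (ℓ', p', q')) (pos (ℓ, p, q)) ^ 2 =
      ((17 : ℝ) / 25 * ((ℓ' - ℓ : ℤ) : ℝ) + 1 / 50 * ((ℓ' % 2 - ℓ % 2 : ℤ) : ℝ)) ^ 2 +
      (((p' - p : ℤ) : ℝ) + ((ℓ' % 2 - ℓ % 2 : ℤ) : ℝ) / 2) ^ 2 +
      (((q' - q : ℤ) : ℝ) + ((ℓ' % 2 - ℓ % 2 : ℤ) : ℝ) / 2) ^ 2 := by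
  rw [EuclideanSpace.dist_eq, Real.sq_sqrt (Finset.sum_nonneg fun _ _ => by positivity),
    Fin.sum_univ_three, Real.dist_eq, Real.dist_eq, Real.dist_eq, sq_abs, sq_abs, sq_abs,
    pos_apply_zero, pos_apply_one, pos_apply_two, pos_apply_zero, pos_apply_one, pos_apply_two]
  push_cast
  ring

/-- An integer with square `< 4` lies in `{-1, 0, 1}`. [folklore] -/
theorem abs_le_one_of_sq_lt_four {n : ℤ} (hn : n ^ 2 < 4) : -1 ≤ n ∧ n ≤ 1 := by
  constructor <;> nlinarith

/-- **Uniform discreteness of the witness**: distinct sites are at squared distance `≥ 2339/2500`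
(`= (33/50)² + 1/2`, attained by the short interlayer bonds). -/
theorem le_dist_pos_sq {ℓ p q ℓ' p' q' : ℤ} (hne : (ℓ', p', q') ≠ (ℓ, p, q)) :
    (2339 : ℝ) / 2500 ≤ dist (pos (ℓ', p', q')) (pos (ℓ, p, q)) ^ 2 := by
  rw [dist_pos_sq]
  set D : ℤ := ℓ' - ℓ with hD
  set e : ℤ := ℓ' % 2 - ℓ % 2 with he
  set m : ℤ := p' - p with hm
  set n : ℤ := q' - q with hn
  have hcase : (D = 0 ∧ e = 0) ∨ ((D = 1 ∨ D = -1) ∧ (e = 1 ∨ e = -1)) ∨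
      ((2 ≤ D ∨ D ≤ -2) ∧ (-1 ≤ e ∧ e ≤ 1)) := by omega
  rcases hcase with ⟨hD0, he0⟩ | ⟨hD1, he1⟩ | ⟨hD2, he2⟩
  · -- same layer: an integer vector of the square lattice
    have hmn : m ≠ 0 ∨ n ≠ 0 := by
      by_contra hmn
      push Not at hmn
      apply hne
      simp only [Prod.mk.injEq]
      omega
    have h1 : (1 : ℝ) ≤ (m : ℝ) ^ 2 + (n : ℝ) ^ 2 := by
      rcases hmn with h | h
      · have := ((one_le_sq_iff_one_le_abs _).2 (Int.one_le_abs h))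
        have : (1 : ℝ) ≤ (m : ℝ) ^ 2 := by exact_mod_cast this
        nlinarith [sq_nonneg (n : ℝ)]
      · have := ((one_le_sq_iff_one_le_abs _).2 (Int.one_le_abs h))
        have : (1 : ℝ) ≤ (n : ℝ) ^ 2 := by exact_mod_cast this
        nlinarith [sq_nonneg (m : ℝ)]
    rw [hD0, he0]
    push_cast
    nlinarith
  · -- adjacent layers: |Δ₀| ≥ 33/50 and the lateral offsets are half-odd integers
    have hodd1 : (1 : ℝ) ≤ ((2 * m + e : ℤ) : ℝ) ^ 2 := by
      exact_mod_cast ((one_le_sq_iff_one_le_abs _).2 (Int.one_le_abs (show 2 * m + e ≠ 0 by omega)))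
    have hodd2 : (1 : ℝ) ≤ ((2 * n + e : ℤ) : ℝ) ^ 2 := by
      exact_mod_cast ((one_le_sq_iff_one_le_abs _).2 (Int.one_le_abs (show 2 * n + e ≠ 0 by omega)))
    push_cast at hodd1 hodd2
    have h0 : (1089 : ℝ) / 2500 ≤ ((17 : ℝ) / 25 * (D : ℝ) + 1 / 50 * (e : ℝ)) ^ 2 := by
      rcases hD1 with h | h <;> rcases he1 with h' | h' <;> rw [h, h'] <;> norm_num
    nlinarith
  · -- two or more layers apart: |Δ₀| ≥ 67/50
    have hD' : (2 : ℝ) ≤ (D : ℝ) ∨ (D : ℝ) ≤ -2 := by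
      rcases hD2 with h | h
      · left; exact_mod_cast h
      · right; exact_mod_cast h
    have he' : (-1 : ℝ) ≤ (e : ℝ) ∧ (e : ℝ) ≤ 1 := ⟨by exact_mod_cast he2.1, by exact_mod_cast he2.2⟩
    have h0 : (4489 : ℝ) / 2500 ≤ ((17 : ℝ) / 25 * (D : ℝ) + 1 / 50 * (e : ℝ)) ^ 2 := by
      rcases hD' with h | h
      · have : (67 : ℝ) / 50 ≤ (17 : ℝ) / 25 * (D : ℝ) + 1 / 50 * (e : ℝ) := by linarith
        nlinarith
      · have : (17 : ℝ) / 25 * (D : ℝ) + 1 / 50 * (e : ℝ) ≤ -(67 / 50) := by linarith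
        nlinarith
    nlinarith [sq_nonneg ((m : ℝ) + (e : ℝ) / 2), sq_nonneg ((n : ℝ) + (e : ℝ) / 2)]

/-- Distinct sites are `≥ 55/57` apart (`(55/57)² = 3025/3249 < 2339/2500`). -/
theorem le_dist_pos {u u' : ℤ × ℤ × ℤ} (hne : u' ≠ u) : (55 : ℝ) / 57 ≤ dist (pos u') (pos u) := by
  obtain ⟨ℓ, p, q⟩ := u
  obtain ⟨ℓ', p', q'⟩ := u'
  have h := le_dist_pos_sq hne
  have hd : 0 ≤ dist (pos (ℓ', p', q')) (pos (ℓ, p, q)) := dist_nonneg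
  nlinarith

/-- The twelve neighbour labels of `u = (ℓ, p, q)` (`r = ℓ % 2`): four in the layer, four above, four below. -/
def nbrOff (r : ℤ) : Fin 12 → ℤ × ℤ × ℤ :=
  ![(0, 1, 0), (0, -1, 0), (0, 0, 1), (0, 0, -1),
    (1, r, r), (1, r - 1, r), (1, r, r - 1), (1, r - 1, r - 1),
    (-1, r, r), (-1, r - 1, r), (-1, r, r - 1), (-1, r - 1, r - 1)]

/-- The `t`-th neighbour label of `u`. -/
def nbr (u : ℤ × ℤ × ℤ) (t : Fin 12) : ℤ × ℤ × ℤ :=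
  (u.1 + (nbrOff (u.1 % 2) t).1, u.2.1 + (nbrOff (u.1 % 2) t).2.1, u.2.2 + (nbrOff (u.1 % 2) t).2.2)

/-- The neighbour labels are pairwise distinct. -/
theorem nbr_injective (u : ℤ × ℤ × ℤ) : Function.Injective (nbr u) := by
  intro t t' h
  simp only [nbr, Prod.mk.injEq] at h
  obtain ⟨h1, h2, h3⟩ := h
  fin_cases t <;> fin_cases t' <;> simp [nbrOff] at h1 h2 h3 ⊢ <;> omega

/-- A neighbour label differs from the centre. -/
theorem nbr_ne (u : ℤ × ℤ × ℤ) (t : Fin 12) : nbr u t ≠ u := by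
  obtain ⟨ℓ, p, q⟩ := u
  intro h
  simp only [nbr, Prod.mk.injEq] at h
  obtain ⟨h1, h2, h3⟩ := h
  fin_cases t <;> simp [nbrOff] at h1 h2 h3

/-- **The twelve neighbours are within distance `1`** (squared distances `1`, `99/100`, `2339/2500`). -/
theorem dist_nbr_sq_le (u : ℤ × ℤ × ℤ) (t : Fin 12) : dist (pos (nbr u t)) (pos u) ^ 2 ≤ 1 := by
  obtain ⟨ℓ, p, q⟩ := u
  have key : ∀ d m n : ℤ, dist (pos (ℓ + d, p + m, q + n)) (pos (ℓ, p, q)) ^ 2 =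
      ((17 : ℝ) / 25 * (d : ℝ) + 1 / 50 * (((ℓ + d) % 2 - ℓ % 2 : ℤ) : ℝ)) ^ 2 +
      ((m : ℝ) + (((ℓ + d) % 2 - ℓ % 2 : ℤ) : ℝ) / 2) ^ 2 +
      ((n : ℝ) + (((ℓ + d) % 2 - ℓ % 2 : ℤ) : ℝ) / 2) ^ 2 := by
    intro d m n
    rw [dist_pos_sq]
    push_cast
    ring
  have hr : ℓ % 2 = 0 ∨ ℓ % 2 = 1 := by omega
  have e0 : (ℓ + 0) % 2 - ℓ % 2 = 0 := by omega
  have eup : (ℓ + 1) % 2 - ℓ % 2 = 1 - 2 * (ℓ % 2) := by omega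
  have edn : (ℓ + -1) % 2 - ℓ % 2 = 1 - 2 * (ℓ % 2) := by omega
  fin_cases t
  · show dist (pos (ℓ + 0, p + 1, q + 0)) (pos (ℓ, p, q)) ^ 2 ≤ 1
    rw [key, e0]; push_cast; norm_num
  · show dist (pos (ℓ + 0, p + -1, q + 0)) (pos (ℓ, p, q)) ^ 2 ≤ 1
    rw [key, e0]; push_cast; norm_num
  · show dist (pos (ℓ + 0, p + 0, q + 1)) (pos (ℓ, p, q)) ^ 2 ≤ 1
    rw [key, e0]; push_cast; norm_num
  · show dist (pos (ℓ + 0, p + 0, q + -1)) (pos (ℓ, p, q)) ^ 2 ≤ 1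
    rw [key, e0]; push_cast; norm_num
  · show dist (pos (ℓ + 1, p + ℓ % 2, q + ℓ % 2)) (pos (ℓ, p, q)) ^ 2 ≤ 1
    rw [key, eup]; rcases hr with h | h <;> rw [h] <;> push_cast <;> norm_num
  · show dist (pos (ℓ + 1, p + (ℓ % 2 - 1), q + ℓ % 2)) (pos (ℓ, p, q)) ^ 2 ≤ 1
    rw [key, eup]; rcases hr with h | h <;> rw [h] <;> push_cast <;> norm_num
  · show dist (pos (ℓ + 1, p + ℓ % 2, q + (ℓ % 2 - 1))) (pos (ℓ, p, q)) ^ 2 ≤ 1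
    rw [key, eup]; rcases hr with h | h <;> rw [h] <;> push_cast <;> norm_num
  · show dist (pos (ℓ + 1, p + (ℓ % 2 - 1), q + (ℓ % 2 - 1))) (pos (ℓ, p, q)) ^ 2 ≤ 1
    rw [key, eup]; rcases hr with h | h <;> rw [h] <;> push_cast <;> norm_num
  · show dist (pos (ℓ + -1, p + ℓ % 2, q + ℓ % 2)) (pos (ℓ, p, q)) ^ 2 ≤ 1
    rw [key, edn]; rcases hr with h | h <;> rw [h] <;> push_cast <;> norm_num
  · show dist (pos (ℓ + -1, p + (ℓ % 2 - 1), q + ℓ % 2)) (pos (ℓ, p, q)) ^ 2 ≤ 1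
    rw [key, edn]; rcases hr with h | h <;> rw [h] <;> push_cast <;> norm_num
  · show dist (pos (ℓ + -1, p + ℓ % 2, q + (ℓ % 2 - 1))) (pos (ℓ, p, q)) ^ 2 ≤ 1
    rw [key, edn]; rcases hr with h | h <;> rw [h] <;> push_cast <;> norm_num
  · show dist (pos (ℓ + -1, p + (ℓ % 2 - 1), q + (ℓ % 2 - 1))) (pos (ℓ, p, q)) ^ 2 ≤ 1
    rw [key, edn]; rcases hr with h | h <;> rw [h] <;> push_cast <;> norm_num

/-- The twelve neighbours are within distance `1`. -/
theorem dist_nbr_le (u : ℤ × ℤ × ℤ) (t : Fin 12) : dist (pos (nbr u t)) (pos u) ≤ 1 := by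
  have h := dist_nbr_sq_le u t
  have hd : 0 ≤ dist (pos (nbr u t)) (pos u) := dist_nonneg
  nlinarith

/-- **Classification of the `11/10`-neighbourhood**: a site at squared distance `≤ 121/100` from `u` is
`u` itself or one of its twelve neighbours. -/
theorem eq_nbr_of_dist_sq_le {u u' : ℤ × ℤ × ℤ} (hne : u' ≠ u)
    (hd : dist (pos u') (pos u) ^ 2 ≤ 121 / 100) : ∃ t : Fin 12, u' = nbr u t := by
  obtain ⟨ℓ, p, q⟩ := u
  obtain ⟨ℓ', p', q'⟩ := u'
  rw [dist_pos_sq] at hd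
  set D : ℤ := ℓ' - ℓ with hD
  set e : ℤ := ℓ' % 2 - ℓ % 2 with he
  set m : ℤ := p' - p with hm
  set n : ℤ := q' - q with hn
  set r : ℤ := ℓ % 2 with hr
  have hcase : (D = 0 ∧ e = 0) ∨ ((D = 1 ∨ D = -1) ∧ e = 1 - 2 * r ∧ (r = 0 ∨ r = 1)) ∨
      ((2 ≤ D ∨ D ≤ -2) ∧ (-1 ≤ e ∧ e ≤ 1)) := by omega
  rcases hcase with ⟨hD0, he0⟩ | ⟨hD1, he1, hr1⟩ | ⟨hD2, he2⟩
  · -- same layer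
    rw [hD0, he0] at hd
    push_cast at hd
    have hm2 : m ^ 2 < 4 := by
      by_contra h4
      push Not at h4
      have : (4 : ℝ) ≤ (m : ℝ) ^ 2 := by exact_mod_cast h4
      nlinarith [sq_nonneg (n : ℝ)]
    have hn2 : n ^ 2 < 4 := by
      by_contra h4
      push Not at h4
      have : (4 : ℝ) ≤ (n : ℝ) ^ 2 := by exact_mod_cast h4
      nlinarith [sq_nonneg (m : ℝ)]
    have hm1 := abs_le_one_of_sq_lt_four hm2
    have hn1 := abs_le_one_of_sq_lt_four hn2
    have hmn : ¬ (m ≠ 0 ∧ n ≠ 0) := by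
      rintro ⟨h1, h2⟩
      have a1 : (1 : ℝ) ≤ (m : ℝ) ^ 2 := by exact_mod_cast ((one_le_sq_iff_one_le_abs _).2 (Int.one_le_abs h1))
      have a2 : (1 : ℝ) ≤ (n : ℝ) ^ 2 := by exact_mod_cast ((one_le_sq_iff_one_le_abs _).2 (Int.one_le_abs h2))
      nlinarith
    have hmn0 : ¬ (m = 0 ∧ n = 0) := by
      rintro ⟨h1, h2⟩
      apply hne
      simp only [Prod.mk.injEq]
      omega
    have h4 : (m = 1 ∧ n = 0) ∨ (m = -1 ∧ n = 0) ∨ (m = 0 ∧ n = 1) ∨ (m = 0 ∧ n = -1) := by omega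
    rcases h4 with ⟨h1, h2⟩ | ⟨h1, h2⟩ | ⟨h1, h2⟩ | ⟨h1, h2⟩
    · exact ⟨0, by simp only [nbr, nbrOff, Prod.mk.injEq]; simp; omega⟩
    · exact ⟨1, by simp only [nbr, nbrOff, Prod.mk.injEq]; simp; omega⟩
    · exact ⟨2, by simp only [nbr, nbrOff, Prod.mk.injEq]; simp; omega⟩
    · exact ⟨3, by simp only [nbr, nbrOff, Prod.mk.injEq]; simp; omega⟩
  · -- adjacent layers
    have h0 : (1089 : ℝ) / 2500 ≤ ((17 : ℝ) / 25 * (D : ℝ) + 1 / 50 * (e : ℝ)) ^ 2 := by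
      have he1' : e = 1 ∨ e = -1 := by omega
      rcases hD1 with h | h <;> rcases he1' with h' | h' <;> rw [h, h'] <;> norm_num
    have hm4 : (2 * m + e) ^ 2 < 4 := by
      by_contra h4
      push Not at h4
      have : (4 : ℝ) ≤ ((2 * m + e : ℤ) : ℝ) ^ 2 := by exact_mod_cast h4
      push_cast at this
      nlinarith [sq_nonneg ((n : ℝ) + (e : ℝ) / 2)]
    have hn4 : (2 * n + e) ^ 2 < 4 := by
      by_contra h4
      push Not at h4
      have : (4 : ℝ) ≤ ((2 * n + e : ℤ) : ℝ) ^ 2 := by exact_mod_cast h4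
      push_cast at this
      nlinarith [sq_nonneg ((m : ℝ) + (e : ℝ) / 2)]
    have hm1 := abs_le_one_of_sq_lt_four hm4
    have hn1 := abs_le_one_of_sq_lt_four hn4
    have hm' : m = r ∨ m = r - 1 := by omega
    have hn' : n = r ∨ n = r - 1 := by omega
    rcases hD1 with hDv | hDv <;> rcases hm' with hmv | hmv <;> rcases hn' with hnv | hnv
    · exact ⟨4, by simp only [nbr, nbrOff, Prod.mk.injEq]; simp; omega⟩
    · exact ⟨6, by simp only [nbr, nbrOff, Prod.mk.injEq]; simp; omega⟩
    · exact ⟨5, by simp only [nbr, nbrOff, Prod.mk.injEq]; simp; omega⟩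
    · exact ⟨7, by simp only [nbr, nbrOff, Prod.mk.injEq]; simp; omega⟩
    · exact ⟨8, by simp only [nbr, nbrOff, Prod.mk.injEq]; simp; omega⟩
    · exact ⟨10, by simp only [nbr, nbrOff, Prod.mk.injEq]; simp; omega⟩
    · exact ⟨9, by simp only [nbr, nbrOff, Prod.mk.injEq]; simp; omega⟩
    · exact ⟨11, by simp only [nbr, nbrOff, Prod.mk.injEq]; simp; omega⟩
  · -- far layers: impossible
    exfalso
    have hD' : (2 : ℝ) ≤ (D : ℝ) ∨ (D : ℝ) ≤ -2 := by
      rcases hD2 with h | h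
      · left; exact_mod_cast h
      · right; exact_mod_cast h
    have he' : (-1 : ℝ) ≤ (e : ℝ) ∧ (e : ℝ) ≤ 1 := ⟨by exact_mod_cast he2.1, by exact_mod_cast he2.2⟩
    have h0 : (4489 : ℝ) / 2500 ≤ ((17 : ℝ) / 25 * (D : ℝ) + 1 / 50 * (e : ℝ)) ^ 2 := by
      rcases hD' with h | h
      · have : (67 : ℝ) / 50 ≤ (17 : ℝ) / 25 * (D : ℝ) + 1 / 50 * (e : ℝ) := by linarith
        nlinarith
      · have : (17 : ℝ) / 25 * (D : ℝ) + 1 / 50 * (e : ℝ) ≤ -(67 / 50) := by linarith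
        nlinarith
    nlinarith [sq_nonneg ((m : ℝ) + (e : ℝ) / 2), sq_nonneg ((n : ℝ) + (e : ℝ) / 2)]

/-- **The pair-sum defect of the witness**: the neighbour above `(1, r, r)` and the neighbour below
`(-1, r-1, r-1)` have offsets summing to `(±1/25, 0, 0)` — norm `1/25`. -/
theorem norm_pairSum_nbr (u : ℤ × ℤ × ℤ) :
    ‖(pos (nbr u 4) - pos u) + (pos (nbr u 11) - pos u)‖ = 1 / 25 := by
  obtain ⟨ℓ, p, q⟩ := u
  have hr : ℓ % 2 = 0 ∨ ℓ % 2 = 1 := by omega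
  have hup : (ℓ + 1) % 2 = 1 - ℓ % 2 := by omega
  have hdn : (ℓ + -1) % 2 = 1 - ℓ % 2 := by omega
  have hsq : ‖(pos (nbr (ℓ, p, q) 4) - pos (ℓ, p, q)) + (pos (nbr (ℓ, p, q) 11) - pos (ℓ, p, q))‖ ^ 2
      = (1 / 25) ^ 2 := by
    rw [EuclideanSpace.norm_eq, Real.sq_sqrt (Finset.sum_nonneg fun _ _ => by positivity),
      Fin.sum_univ_three, Real.norm_eq_abs, Real.norm_eq_abs, Real.norm_eq_abs, sq_abs, sq_abs, sq_abs]
    simp only [PiLp.add_apply, PiLp.sub_apply, pos_apply_zero, pos_apply_one, pos_apply_two, nbr, nbrOff,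
      Fin.isValue, Matrix.cons_val, hup, hdn]
    rcases hr with h | h <;> simp only [h] <;> push_cast <;> ring
  have hnn : 0 ≤ ‖(pos (nbr (ℓ, p, q) 4) - pos (ℓ, p, q)) + (pos (nbr (ℓ, p, q) 11) - pos (ℓ, p, q))‖ :=
    norm_nonneg _
  nlinarith

end Summit.AtomisticToContinuum.Crystallization.Theorems.GapTwelveToBarlow.Negative.WitnessLattice
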